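import Literature.NumberTheory.Transcendental.KaehlerHodge
import HarnessLib

/-!
# `finite_dolbeaultHarmonicForms`: corrected statement (holomorphic atlas as a binder)

`Literature/NumberTheory/Transcendental/KaehlerHodge.lean` renders Voisin's finite-dimensionality
of the spaces `ℋ^{p,q}` of `∂̄`-harmonic forms on a compact Hermitian manifold (Voisin (2002),
Cor. 5.20: `Δ_∂̄` is elliptic; Thm. 5.22: the kernel of an elliptic operator on a compact manifold
is finite-dimensional; Thm. 5.24 / Cor. 5.25) as the named fact
`Literature.NumberTheory.Transcendental.finite_dolbeaultHarmonicForms g o`. That `def … : Prop`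
is an M5 mechanical rewrite of a sorried theorem and abstracts only the section variables its
body uses: its binders are `E, M, k, m, [FiniteDimensional ℂ E], n, [Fact (finrank ℝ E = n)],
[IsManifold 𝓘(ℝ, E) ∞ M], g, o` — the **holomorphic atlas** `[IsManifold 𝓘(ℂ, E) ω M]` of the
section is *not* among them (the metric `g` is typed over the real `C^∞` structure only). As
elaborated, the fact therefore speaks about an arbitrary compact `C^∞` real manifold charted on
the complex vector space `E`, on which the "complex structure" `J_x = i •` of
`TangentSpace 𝓘(ℝ, E) x = E` is read in the preferred chart `chartAt x`, an arbitrary member of a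
merely smooth atlas: `J` is then not an almost-complex structure, the type projections of smooth
forms are not even continuous, and the chart-wise exterior derivative `mextDeriv` (junk value `0`
at points of non-differentiability) annihilates them. In that generality the statement is false
(a flat torus `ℂ/ℤ[i]` with holomorphic and anti-holomorphic local charts interleaved on a dense
set and its complement: every smooth function is then `Δ_∂̄`-harmonic of type `(0,0)`), exactly
as the sibling facts `isSmoothForm_mcoderiv` / `isSmoothForm_hodgeStar` were found false for
want of their dropped instance binders (`RiemannianHodgeSmoothCounterexample.lean`,
`RiemannianHodgeRoughMetric.lean`).

This file records the **corrected statement** `finite_dolbeaultHarmonicForms_of_isManifold`,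
with the holomorphic atlas as an explicit binder of the `def` (the pattern of
`Literature.NumberTheory.Transcendental.finite_dolbeaultCohomology` in `Dolbeault.lean`) and the
body unchanged, together with the definitional `iff` with the old `Prop` at a complex manifold.
With a holomorphic atlas every ingredient (`IsOfType`, `dolbeaultBar`, the `ℂ`-linear Hodge star
of the smooth Hermitian metric `g`, `dolbeaultLaplacian`) is the honest object, and the statement
is Voisin's theorem; its proof is the elliptic theory of Thm. 5.22 ("which we will use without
proof (see Demailly 1996)"; Remark 5.26: "There is no easy proof"), absent from Mathlib
(pinned v4.32.0) and from `Literature/` — it stays a named fact here. The old def has no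
dependents.

## References

* C. Voisin, *Hodge Theory and Complex Algebraic Geometry I* (2002), §5.2.1 (Def. 5.17),
  Lemma 5.19, Cor. 5.20, §5.2.3 Thm. 5.22, §5.3.1 Thm. 5.24, Cor. 5.25, Remark 5.26.
* J.-P. Demailly, *Complex Analytic and Differential Geometry* (1996), Ch. VI §3 (the elliptic
  theory behind Thm. 5.22).
-/

noncomputable section

open scoped Manifold ContDiff Topology
open Bundle Module

namespace Literature.NumberTheory.Transcendental

variable {E : Type*} [NormedAddCommGroup E] [NormedSpace ℂ E]
  {M : Type*} [TopologicalSpace M] [ChartedSpace E M] {k m : ℕ}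
  [FiniteDimensional ℂ E] {n : ℕ} [Fact (finrank ℝ E = n)] [IsManifold 𝓘(ℝ, E) ∞ M]
  (g : ContMDiffRiemannianMetric 𝓘(ℝ, E) ∞ E (fun x : M ↦ TangentSpace 𝓘(ℝ, E) x))
  (o : (x : M) → Orientation ℝ (TangentSpace 𝓘(ℝ, E) x) (Fin n))

/-- **Finite-dimensionality of `ℋ^{p,q}` on a compact Hermitian manifold — corrected statement**
(Voisin (2002), Cor. 5.20: `Δ_∂̄` is elliptic, and Thm. 5.22: "Let `P : E → F` be an elliptic
differential operator on a compact manifold … Then `Ker P ⊂ C^∞(E)` is finite-dimensional";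
cf. Thm. 5.24 / Cor. 5.25 (b)). For a **complex** manifold `M` (holomorphic atlas
`[IsManifold 𝓘(ℂ, E) ω M]`, an explicit binder of this def) that is compact and Hausdorff, a
smooth Riemannian metric `g` Hermitian for the complex structure and an orientation family `o`
with smooth volume form, the space `ℋ^{p,q} = dolbeaultHarmonicForms o p q h` of `∂̄`-harmonic
`(p,q)`-forms among the complex `k`-forms (`h : k + m = n`; it is `⊥` unless `p + q = k`) is
finite-dimensional over `ℂ`. This corrects
`Literature.NumberTheory.Transcendental.finite_dolbeaultHarmonicForms`, whose `def` does not
abstract the unused section instance `[IsManifold 𝓘(ℂ, E) ω M]` and is false for general smooth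
real atlases (module docstring); same body otherwise
(`finite_dolbeaultHarmonicForms_of_isManifold_iff`). Not proved here: the proof is the elliptic
theory of Voisin's Thm. 5.22 (Sobolev spaces of sections, Gårding's inequality, Rellich's lemma,
elliptic regularity), absent upstream. [cite: Voisin2002, Cor. 5.20, Thm. 5.22, Cor. 5.25] -/
def finite_dolbeaultHarmonicForms_of_isManifold [IsManifold 𝓘(ℂ, E) ω M] : Prop :=
  ∀ [CompactSpace M] [T2Space M] (hg : g.toRiemannianMetric.IsHermitian) {p q : ℕ} (h : k + m = n),
    letI : RiemannianBundle (fun x : M ↦ TangentSpace 𝓘(ℝ, E) x) := ⟨g.toRiemannianMetric⟩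
    Literature.Geometry.Kaehler.IsSmoothForm (Literature.Geometry.Kaehler.riemannianVolumeForm o) →
      Module.Finite ℂ ↥(dolbeaultHarmonicForms o p q h)

/-- At a complex manifold the corrected fact *is* the old `Prop`
`finite_dolbeaultHarmonicForms g o` (same body), so a future discharge of either serves both.
[folklore] -/
theorem finite_dolbeaultHarmonicForms_of_isManifold_iff [IsManifold 𝓘(ℂ, E) ω M] :
    finite_dolbeaultHarmonicForms_of_isManifold (k := k) (m := m) g o ↔
      finite_dolbeaultHarmonicForms (k := k) (m := m) g o :=
  Iff.rfl

end Literature.NumberTheory.Transcendental
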